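import Summits.Ventures.YMGap.RobustBall.LatticeSumL1
import Summits.Ventures.YMGap.Thresholds.PlaquetteSusceptibility
import Summits.Ventures.YMGap.Thresholds.MassGapAtMassive
import Mathlib.Logic.Equiv.Sum
import HarnessLib

/-!
# Venture YMGap, track ROBUST-BALL — THE SUSCEPTIBILITY IS THE TIME-SUM OF THE ZERO-MOMENTUM CORRELATOR:
# `Σ_{v∈ℤ^d} cov_μ(F₁, F₂∘θ_v) = Σ_{t∈ℤ} Σ_{v : v_i = t} cov_μ(F₁, F₂∘θ_v)` for every massive state and every direction

HONEST FRAMING. WHAT THIS IS: a venture file (cell `pub-ymgap`, track Y2 ROBUST-BALL, seat ds-3, theorems only): the lattice-sum dictionary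
item between the cell's SUSCEPTIBILITY currency (ds-1's C-SUS / this seat's C-TVAR `χ(F₁,F₂) = Σ_v cov_μ(F₁, F₂∘θ_v)`) and the ZERO-MOMENTUM
correlator of C-TSLICE (`C_i(t) = Σ_{v : v_i = t} cov_μ(F₁, F₂∘θ_v)`, `TimesliceCorrelatorDecay.lean`): for an absolutely summable lattice
function the slices are absolutely summable, the slice sums are absolutely summable in `t`, and the total is the time-sum of the slice
sums (`tsum_eq_tsum_timeslice`, Fubini over `ℤ^d = ⊔_t {v_i = t}`); for every MASSIVE state (`IsMassiveState`, `d = 4`) and all bounded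
measurable gauge-invariant local `F₁, F₂` the autocovariance is absolutely summable (`summable_abs_of_decayRate`, rb-p1's `ℓ¹` lattice sum),
so `χ(F₁,F₂) = Σ_{t∈ℤ} C_i(t)` in every direction `i` (`susceptibility_eq_tsum_timeslice_of_isMassiveState`); cell: `SU(2)` on `ℤ⁴`,
`|β_W| ≤ 9/25` (`su2_wilson_susceptibility_eq_tsum_timeslice`). This is the identity practitioners use to read `χ` off `C(t)`.
WHAT THIS IS NOT: bookkeeping only; no new decay or positivity statement; lattice; nothing about the continuum or the Clay problem.

References: I. Montvay, G. Münster, *Quantum Fields on a Lattice* (1994), §2.4; the tree's `LatticeSumL1.lean`,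
`TimesliceCorrelatorDecay.lean`.
-/

noncomputable section

open MeasureTheory Filter Function ProbabilityTheory Real
open scoped NNReal
open Literature.Probability.LatticeModels hiding configShift configShift_apply
open Literature.MathematicalPhysics.QuantumLattice
open Literature.MathematicalPhysics.QuantumFieldTheory hiding ZdEdge Site IsLocalObservable
open Literature.Barriers.QuantumFields (IsMassiveState)
open Summit.Ventures.YMGap.PlaquetteSusceptibility (l1_le_mul_norm)

namespace Summit.Ventures.YMGap.RobustBall

namespace SusceptibilityTimeslice

variable {d : ℕ}

/-! ### Generic: Fubini over the slices of `ℤ^d` -/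

/-- **Fubini over timeslices**: for an absolutely summable `G : ℤ^d → ℝ` and a direction `i`, every slice sum `Σ_{v : v_i = t} G v`
converges absolutely, the slice sums are summable in `t ∈ ℤ`, and `Σ_v G v = Σ_{t∈ℤ} Σ_{v : v_i = t} G v`. [folklore] -/
theorem tsum_eq_tsum_timeslice {G : Site d → ℝ} (hG : Summable fun v => |G v|) (i : Fin d) :
    (∀ t : ℤ, Summable fun v : {v : Site d // v i = t} => G v) ∧
      (Summable fun t : ℤ => ∑' v : {v : Site d // v i = t}, G v) ∧
      ∑' v : Site d, G v = ∑' t : ℤ, ∑' v : {v : Site d // v i = t}, G v := by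
  -- transport along `ℤ^d ≃ Σ t, {v // v_i = t}`
  set e := (Equiv.sigmaFiberEquiv fun v : Site d => v i) with he
  have hGs : Summable G := hG.of_abs
  have hσ : Summable (G ∘ e) := (e.summable_iff).2 hGs
  have hσabs : Summable (fun p => |(G ∘ e) p|) := (e.summable_iff (f := fun v => |G v|)).2 hG
  have hfib : ∀ t : ℤ, Summable fun v : {v : Site d // v i = t} => (G ∘ e) ⟨t, v⟩ := fun t =>
    (Summable.of_nonneg_of_le (fun v => abs_nonneg _) (fun v => le_rfl) (hσabs.sigma_factor t)).of_abs
  refine ⟨fun t => hfib t, ?_, ?_⟩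
  · exact hσ.sigma' hfib
  · rw [← e.tsum_eq G]
    exact hσ.tsum_sigma' hfib

/-- An `ℓ^∞`-exponentially decaying lattice function is absolutely summable (`‖v‖_∞ ≥ ‖v‖₁/d` and rb-p1's `ℓ¹` lattice sum; a second
statement shape, kept for independence of this file). [folklore] -/
theorem summable_abs_of_decayRate (hd : 1 ≤ d) {G : Site d → ℝ} {m : ℝ}
    (h : HasExponentialDecayRate G m) : Summable fun v => |G v| := by
  obtain ⟨hm, C, hC⟩ := h
  have hd0 : (0 : ℝ) < d := by exact_mod_cast hd
  set r : ℝ := exp (-(m / d)) with hr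
  have hr0 : 0 ≤ r := (exp_pos _).le
  have hr1 : r < 1 := Real.exp_lt_one_iff.2 (neg_neg_of_pos (by positivity))
  refine Summable.of_nonneg_of_le (fun v => abs_nonneg _) (fun v => ?_)
    (((summable_pow_l1_sub hr0 hr1 (0 : Site d)).1).mul_left (max C 0))
  rw [zero_sub, l1_neg]
  have h3 : exp (-m * ‖v‖) ≤ r ^ l1 v := by
    rw [hr, ← Real.exp_nat_mul]
    refine exp_le_exp.2 ?_
    have hl : (l1 v : ℝ) ≤ d * ‖v‖ := l1_le_mul_norm v
    have : (l1 v : ℝ) * (m / d) ≤ m * ‖v‖ := by rw [mul_div_assoc', div_le_iff₀ hd0]; nlinarith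
    linarith
  calc |G v| ≤ C * exp (-m * ‖v‖) := hC v
    _ ≤ max C 0 * exp (-m * ‖v‖) := mul_le_mul_of_nonneg_right (le_max_left _ _) (exp_pos _).le
    _ ≤ max C 0 * r ^ l1 v := mul_le_mul_of_nonneg_left h3 (le_max_right _ _)

/-! ### Massive states and the `SU(2)` cell -/

/-- **THE SUSCEPTIBILITY OF A MASSIVE STATE IS THE TIME-SUM OF ITS ZERO-MOMENTUM CORRELATOR**: for every massive state `μ` on the `ℤ⁴`
link configurations and all bounded measurable gauge-invariant local `F₁, F₂`: the truncated correlation `v ↦ cov_μ(F₁, F₂∘θ_v)` is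
absolutely summable, each timeslice sum `C_i(t) = Σ_{v : v_i = t} cov_μ(F₁, F₂∘θ_v)` converges absolutely, `t ↦ C_i(t)` is summable over
`ℤ`, and `Σ_v cov_μ(F₁, F₂∘θ_v) = Σ_{t∈ℤ} C_i(t)` for every direction `i`. [folklore] -/
theorem susceptibility_eq_tsum_timeslice_of_isMassiveState {G : Type*} [Group G] [MeasurableSpace G]
    {μ : Measure (LGConfig 4 G)} (hμ : IsMassiveState μ) (F₁ F₂ : LGConfig 4 G → ℝ)
    (h₁ : Literature.MathematicalPhysics.QuantumLattice.IsLocalObservable F₁)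
    (h₂ : Literature.MathematicalPhysics.QuantumLattice.IsLocalObservable F₂) (h₁m : Measurable F₁) (h₂m : Measurable F₂)
    (hb₁ : ∃ C, ∀ U, |F₁ U| ≤ C) (hb₂ : ∃ C, ∀ U, |F₂ U| ≤ C) (hg₁ : IsZdGaugeInvariant F₁) (hg₂ : IsZdGaugeInvariant F₂)
    (i : Fin 4) :
    (Summable fun v : Site 4 => |cov[F₁, fun U => F₂ (configShift v U); μ]|) ∧
      (∀ t : ℤ, Summable fun v : {v : Site 4 // v i = t} => cov[F₁, fun U => F₂ (configShift (v : Site 4) U); μ]) ∧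
      (Summable fun t : ℤ => ∑' v : {v : Site 4 // v i = t}, cov[F₁, fun U => F₂ (configShift (v : Site 4) U); μ]) ∧
      ∑' v : Site 4, cov[F₁, fun U => F₂ (configShift v U); μ] =
        ∑' t : ℤ, ∑' v : {v : Site 4 // v i = t}, cov[F₁, fun U => F₂ (configShift (v : Site 4) U); μ] := by
  obtain ⟨m, hm⟩ := hμ
  have habs := summable_abs_of_decayRate (d := 4) (by norm_num) (hm F₁ F₂ h₁ h₂ h₁m h₂m hb₁ hb₂ hg₁ hg₂)
  exact ⟨habs, tsum_eq_tsum_timeslice habs i⟩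

/-- ★ **CELL — `SU(2)` ON `ℤ⁴` IN THE VERTEX-STAR WINDOW `|β_W| ≤ 9/25`** (tree coupling `b`, `|b| ≤ 9/50`; every DLR state is massive by
`isMassiveState_of_massGapAt` + `su2_massGapAt_of_abs_le`): for every DLR state `μ`, all bounded measurable gauge-invariant local
`F₁, F₂` and every direction `i`: `Σ_v cov_μ(F₁, F₂∘θ_v) = Σ_{t∈ℤ} Σ_{v : v_i = t} cov_μ(F₁, F₂∘θ_v)`, all sums absolutely convergent —
the susceptibility is the time-sum of the zero-momentum correlator. [folklore] -/
theorem su2_wilson_susceptibility_eq_tsum_timeslice {b : ℝ} (hb : |b| ≤ 9 / 50)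
    {μ : Measure (LGConfig 4 (Matrix.specialUnitaryGroup (Fin 2) ℂ))}
    (hμ : μ ∈ ymGibbsMeasures (d := 4) (fundamentalRep (Fin 2)) b)
    (F₁ F₂ : LGConfig 4 (Matrix.specialUnitaryGroup (Fin 2) ℂ) → ℝ)
    (h₁ : Literature.MathematicalPhysics.QuantumLattice.IsLocalObservable F₁)
    (h₂ : Literature.MathematicalPhysics.QuantumLattice.IsLocalObservable F₂) (h₁m : Measurable F₁) (h₂m : Measurable F₂)
    (hb₁ : ∃ C, ∀ U, |F₁ U| ≤ C) (hb₂ : ∃ C, ∀ U, |F₂ U| ≤ C) (hg₁ : IsZdGaugeInvariant F₁) (hg₂ : IsZdGaugeInvariant F₂)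
    (i : Fin 4) :
    (Summable fun v : Site 4 => |cov[F₁, fun U => F₂ (configShift v U); μ]|) ∧
      (∀ t : ℤ, Summable fun v : {v : Site 4 // v i = t} => cov[F₁, fun U => F₂ (configShift (v : Site 4) U); μ]) ∧
      (Summable fun t : ℤ => ∑' v : {v : Site 4 // v i = t}, cov[F₁, fun U => F₂ (configShift (v : Site 4) U); μ]) ∧
      ∑' v : Site 4, cov[F₁, fun U => F₂ (configShift v U); μ] =
        ∑' t : ℤ, ∑' v : {v : Site 4 // v i = t}, cov[F₁, fun U => F₂ (configShift (v : Site 4) U); μ] := by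
  have hb' : |b / 2| ≤ 9 / 100 := by rw [abs_div, abs_two]; linarith
  have hμ2 : μ ∈ ymGibbsMeasures (d := 4) (fundamentalRep (Fin 2)) (((2 : ℕ) : ℝ) * (b / 2)) := by
    have e : (((2 : ℕ) : ℝ) * (b / 2)) = b := by push_cast; ring
    rw [e]; exact hμ
  exact susceptibility_eq_tsum_timeslice_of_isMassiveState
    (Summit.Ventures.YMGap.MassGapMassive.isMassiveState_of_massGapAt (N := 2) (by norm_num)
      (ImprovedThresholdStar.su2_massGapAt_of_abs_le hb') μ hμ2) F₁ F₂ h₁ h₂ h₁m h₂m hb₁ hb₂ hg₁ hg₂ i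

end SusceptibilityTimeslice

end Summit.Ventures.YMGap.RobustBall

end
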